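import Mathlib
import Summits.NavierStokesRegularity.NavierStokesRegularity.Theorems.LandauTailLandauTailBlowupShellEnstrophyFloor
import Summits.NavierStokesRegularity.NavierStokesRegularity.Theorems.LandauTailLandauTailBlowupCoreRadiusEnergy
import Summits.NavierStokesRegularity.NavierStokesRegularity.Theorems.LandauTailLandauTailBlowupRescaledDissipation

/-!
# Crux `LandauTail.LandauTailBlowup` (stmt-NavierStokesRegularity-1944), line `registered`, cycle c7:
  stub `landauTail_core_radius_dissipation` — the CORE RADIUS, dissipation form

Helper file on the proof path of the crux item `stmt-NavierStokesRegularity-1944`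
(`Summit.NavierStokesRegularity.NavierStokesRegularity.Theses.LandauTail.LandauTailBlowup`), lead c7: the
registered support stub `landauTail_core_radius_dissipation` (L5), composed from the shell theorem, enstrophy form
(`landauTail_shell_enstrophy_floor`) and the rescaled dissipation bookkeeping (`landauTail_rescaled_dissipation_eq`,
p172915).

THEOREM. For a nonzero steady `(−1)`-homogeneous profile `(U, P)` smooth off the origin there are `c, ε > 0` such
that for every classical unit-viscosity flow `u` on `ℝ³ × (−1,0)`, every scale `0 < λ ≤ 1`, shell radius
`0 < ρ ≤ 1` and window `−1 < s₁ < s₂ < 0`: if `ρ⁵ D_λ < c λ (s₂ − s₁)³`, where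
`D_λ = ∫_{λ²s₁}^{λ²s₂}∫_{B_λ} |∇u|²` is the dissipation of `u` in the corresponding physical slab (a tail of the
finite dissipation integral, so `D_λ → 0` as `λ → 0`), then the rescaling `u_λ` is NOT `L²`-close to the Landau flow
on the shell of radius `ρ`: `∫_{s₁}^{s₂}∫_{ρ/2<|y|<ρ}|u_λ − U|² > ε ρ (s₂ − s₁)`.

Hence the radius of the non-Landau core in the rescaled picture is `≫ λ^{1/5}`, i.e. `≫ (T − t)^{3/5}` in physical
variables — the dissipation half of STRATEGY-CENSUS §F3's window (`β < 3/5`), for every flow and every scale.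

PROOF. If the shell were close, the enstrophy form of the shell theorem gives
`∫_{s₁}^{s₂}∫_{B_ρ}|∇u_λ|² ≥ c (s₂−s₁)³ ρ⁻⁵`, while the dissipation rescales to `λ⁻¹ ∫_{λ²s₁}^{λ²s₂}∫_{B_{λρ}}|∇u|²
≤ λ⁻¹ D_λ`.
-/

set_option linter.dupNamespace false

noncomputable section

open Filter Set Topology MeasureTheory Metric Function
open scoped ENNReal NNReal InnerProductSpace RealInnerProductSpace Laplacian ContDiff
open Literature.Analysis.FluidPDE

namespace Summit.NavierStokesRegularity.NavierStokesRegularity.Theorems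

/-- **L5 — CORE RADIUS, dissipation form** (registered support stub of crux stmt-NavierStokesRegularity-1944, lead
c7): with `D_λ = ∫_{λ²s₁}^{λ²s₂}∫_{B_λ} |∇u|²`, the rescaling `u_λ` of a classical flow is NOT `L²`-close to the Landau
flow on any shell of radius `ρ ≤ 1` with `ρ⁵ D_λ < c λ (s₂ − s₁)³`. [folklore] -/
theorem landauTail_core_radius_dissipation : ∀ (U : EuclideanSpace ℝ (Fin 3) → EuclideanSpace ℝ (Fin 3)) (P : EuclideanSpace ℝ (Fin 3) → ℝ), (ContDiffOn ℝ (⊤ : ℕ∞) U {0}ᶜ ∧ ContDiffOn ℝ (⊤ : ℕ∞) P {0}ᶜ ∧ (∀ x : EuclideanSpace ℝ (Fin 3), x ≠ 0 → Literature.Analysis.FluidPDE.convect U U x + gradient P x = (1 : ℝ) • Laplacian.laplacian U x) ∧ (∀ x : EuclideanSpace ℝ (Fin 3), x ≠ 0 → Literature.Analysis.FluidPDE.VectorCalculus.divergence U x = 0) ∧ (∀ c : ℝ, 0 < c → ∀ x : EuclideanSpace ℝ (Fin 3), U (c • x) = c⁻¹ • U x) ∧ (∃ x : EuclideanSpace ℝ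 (Fin 3), U x ≠ 0)) → ∃ c : ℝ, 0 < c ∧ ∃ ε : ℝ, 0 < ε ∧ ∀ (u : ℝ → EuclideanSpace ℝ (Fin 3) → EuclideanSpace ℝ (Fin 3)) (p : ℝ → EuclideanSpace ℝ (Fin 3) → ℝ), Literature.Analysis.FluidPDE.IsClassicalNSSolutionOn (Set.Ioo (-1) 0) 1 0 u p → ∀ lam : ℝ, 0 < lam → lam ≤ 1 → ∀ ρ : ℝ, 0 < ρ → ρ ≤ 1 → ∀ s₁ s₂ : ℝ, -1 < s₁ → s₁ < s₂ → s₂ < 0 → ENNReal.ofReal (ρ ^ 5) * (∫⁻ z in Set.Ioo (lam ^ 2 * s₁) (lam ^ 2 * s₂) ×ˢ Metric.ball (0 : EuclideanSpace ℝ (Fin 3)) lam, ENNReal.ofReal (Literature.Analysis.FluidPDE.frobeniusNormSq (fderiv ℝ (u z.1) z.2))) < ENNReal.ofReal (c * lam * (s₂ - s₁) ^ 3) → ENNReal.ofReal (ε * ρ * (s₂ - s₁)) < ∫⁻ z in Set.Ioo s₁ s₂ ×ˢ (Metric.ball (0 : EuclideanSpace ℝ (Fin 3)) ρ \ Metric.closedBall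 (0 : EuclideanSpace ℝ (Fin 3)) (ρ / 2)), ‖Literature.Analysis.FluidPDE.nsRescale lam u z.1 z.2 - U z.2‖ₑ ^ 2 := by
  intro U P hprof
  obtain ⟨c, hc, ε, hε, hshell⟩ := landauTail_shell_enstrophy_floor U P hprof
  refine ⟨c, hc, ε, hε, ?_⟩
  intro u p hcl lam hlam0 hlam1 ρ hρ hρ1 s₁ s₂ hs₁ hs₁₂ hs₂ hsmall
  by_contra hnot
  rw [not_lt] at hnot
  have hv := landauTail_coreRadius_nsRescale_classical hcl hlam0 hlam1
  have hE := hshell (nsRescale lam u) (nsRescalePressure lam p) hv ρ hρ hρ1 s₁ s₂ hs₁ hs₁₂ hs₂ hnot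
  set D : ℝ≥0∞ := ∫⁻ z in Ioo (lam ^ 2 * s₁) (lam ^ 2 * s₂) ×ˢ ball (0 : EuclideanSpace ℝ (Fin 3)) lam,
    ENNReal.ofReal (frobeniusNormSq (fderiv ℝ (u z.1) z.2)) with hD_def
  -- the rescaled dissipation is `λ⁻¹ ∫_{λ²s₁}^{λ²s₂}∫_{B_{λρ}} |∇u|² ≤ λ⁻¹ D`
  have hW6 := landauTail_rescaled_dissipation_eq u lam hlam0 ρ s₁ s₂
  have hsub : Ioo (lam ^ 2 * s₁) (lam ^ 2 * s₂) ×ˢ ball (0 : EuclideanSpace ℝ (Fin 3)) (lam * ρ) ⊆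
      Ioo (lam ^ 2 * s₁) (lam ^ 2 * s₂) ×ˢ ball (0 : EuclideanSpace ℝ (Fin 3)) lam :=
    prod_mono Subset.rfl (ball_subset_ball (by nlinarith))
  have hchain : ENNReal.ofReal (c * (s₂ - s₁) ^ 3 / ρ ^ 5) ≤ ENNReal.ofReal lam⁻¹ * D := by
    refine hE.trans ?_
    rw [hW6]
    exact mul_le_mul_right (lintegral_mono_set hsub) _
  -- `D < ∞` from the hypothesis, then the real inequality contradicts `ρ⁵ D < c λ (s₂ − s₁)³`
  have hDtop : D ≠ ⊤ := by
    intro h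
    rw [h, ENNReal.mul_top (by rw [Ne, ENNReal.ofReal_eq_zero, not_le]; positivity : ENNReal.ofReal (ρ ^ 5) ≠ 0)] at hsmall
    exact absurd hsmall (not_lt.2 le_top)
  set d : ℝ := D.toReal with hd_def
  have hd0 : 0 ≤ d := ENNReal.toReal_nonneg
  have hDeq : D = ENNReal.ofReal d := (ENNReal.ofReal_toReal hDtop).symm
  rw [hDeq, ← ENNReal.ofReal_mul (by positivity)] at hsmall
  rw [hDeq, ← ENNReal.ofReal_mul (inv_nonneg.2 hlam0.le)] at hchain
  have h1 : ρ ^ 5 * d < c * lam * (s₂ - s₁) ^ 3 := (ENNReal.ofReal_lt_ofReal_iff (by positivity)).1 hsmall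
  have h2 : c * (s₂ - s₁) ^ 3 / ρ ^ 5 ≤ lam⁻¹ * d := (ENNReal.ofReal_le_ofReal_iff (by positivity)).1 hchain
  rw [div_le_iff₀ (by positivity)] at h2
  have h3 : c * lam * (s₂ - s₁) ^ 3 ≤ ρ ^ 5 * d := by
    have h := mul_le_mul_of_nonneg_left h2 hlam0.le
    calc c * lam * (s₂ - s₁) ^ 3 = lam * (c * (s₂ - s₁) ^ 3) := by ring
      _ ≤ lam * (lam⁻¹ * d * ρ ^ 5) := h
      _ = ρ ^ 5 * d := by field_simp
  exact absurd h1 (not_lt.2 h3)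

end Summit.NavierStokesRegularity.NavierStokesRegularity.Theorems

end
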